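import Summits.NavierStokesRegularity.FluidComputer.PalasekTowerHostLateFadeEngine

/-!
# The forced short-time sup bound REDUCED to a linear Oseen estimate, II: the time integrals and the assembly `OseenConvectBound → ForcedLerayShortTimeBound`

Cell `ns-blowup`, seat `ns-blowup-ecbridge-1` (g6). LABEL: E–C typing / NEGATIVE-lane engine (kernel analysis
+ ONE named linear-analysis hypothesis). WHAT THIS IS NOT: not Navier–Stokes evidence — an a-priori estimate
for GIVEN finite-energy classical solutions of the forced system, conditional on a linear estimate for the
Oseen tensor; nothing about blow-up.

`PalasekTowerHostLateFade.lean` §4 stated the engine hypothesis `Host.ForcedLerayShortTimeBound` (Leray's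
short-time sup bound WITH a Clay force, a-priori form) under which the trap `FirstEpisode` is false
(`Theorems/EpisodeBase/Negative/FirstEpisodeHoldRelease.lean`). This file PROVES it from a strictly smaller,
purely LINEAR hypothesis `OseenConvectBound` (the `L¹`-type bound of the Oseen tensor: the convective
pairing of a bounded continuous `L²` field `a`, `|a| ≤ M`, against the Leray-projected heat kernel
`P(G_{ε+s}(·−x₀)e)` is `≤ C₁ s^{-1/2} M² ‖e‖`, uniformly in `ε`), by Tao's route for Prop. 9.1 WITH force
(`TaoForcedBoundedTotalSpeed.lean`) with the Fourier majorant of the nonlinear term replaced by that bound: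

* `enorm_inner_heatExtension_sub_le_of_bounded` — the regularised tested Duhamel formula WITH force
  (`IsLerayHopfOn.integral_inner_eq_mild_of_hasWeakGradient_forced` against `lerayHeatTest x₀ ε e`), the
  force term by the dispersive bound `eLpNorm_lerayHeatTest_le`, the convective term by `OseenConvectBound`;
* `enorm_sub_heatExtension_le_of_bounded` — `ε → 0⁺`:
  `‖u(t,x₀) − e^{νtΔ}u(0)(x₀)‖ ≤ C₁ M² ∫₀ᵗ (ν(t−τ))^{-1/2} dτ + C ∫₀ᵗ (ν(t−τ))^{-3/4} ‖f(τ)‖₂ dτ`;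
* `lintegral_rpow_neg_half_le`, `lintegral_rpow_neg_three_quarters_mul_le` — the two time integrals
  (`2ν^{-1/2}t^{1/2}`, `4ν^{-3/4}t^{1/4}F`);
* **`forcedLerayShortTimeBound_of_oseenConvectBound : OseenConvectBound → ForcedLerayShortTimeBound`** —
  time shift (`IsClassicalNSSolutionOn.comp_add_right`, `IsSmoothOnHalfSpace.timeShift`,
  `HasRapidSpaceTimeDecay.timeShift`), Leray–Hopf-ness of the classical solution
  (`isLerayHopfOn_of_finiteEnergy_forced_ae` with the PROVED `tao2011_forced_pressure_normalisation_ae_holds`,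
  `clayForce_slice_potential_bounds`, `clayForce_prod_aestronglyMeasurable/eLpNorm_lt_top`), the dispersive
  constant `exists_eLpNorm_top_heatExtension_le`, the heat `L^∞` bound `norm_heatExtension_le` for the free
  term, and `δ₀ = min(1, η/(K₁+K₂))⁴`: `|u(t,x)| ≤ A + (K₁ + K₂) δ₀^{1/4} ≤ A + η`.

ROUTE for `OseenConvectBound` (open here; all inputs in the tree): approximate `lerayHeatTest x₀ ε e` by
divergence-free test fields (`exists_isDivFree_test_approx`), use the duality
`integral_inner_sum_oseenHeat_tensor_eq_neg` (`OseenHeatDuality.lean`) with `heatExtension_lerayHeatTest`,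
pass to the limit, and evaluate the weakly divergence-free `L²` field `w = Σᵢ 𝒩_s(a⊗a)ᵢ bᵢ`
(`memLp_oseenHeat`, `isWeaklyDivFree_sum_oseenHeat_smul`) against `P(G_ε e)` by `integral_inner_lerayHeatTest`:
`|⟪e^{εΔ}w(x₀), e⟫| ≤ ‖w‖_∞‖e‖ ≤ C s^{-1/2} Σ‖aⱼaₖ‖_∞ ‖e‖` (`exists_enorm_oseenHeat_le_rpow`, `p = ⊤`;
`norm_heatExtension_le`).

References: T. Tao, Anal. PDE 6 (2013) = arXiv:1108.1165, Prop. 9.1, (9.2) [cite: Tao2011, Prop. 9.1 (proof, (9.2))];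
J. Leray, Acta Math. 63 (1934) §21 (3.15) [cite: Leray1934, §21 (3.15)]; P. G. Lemarié-Rieusset, CRC 2016,
Thm. 6.1 (6.11)–(6.12) [cite: LemarieRieusset2016, Thm. 6.1]; C. L. Fefferman, Clay problem description (5)(6)
[cite: FeffermanClay2006, (5) (6)].
-/

noncomputable section

open Set MeasureTheory Real Filter Topology
open scoped RealInnerProductSpace ENNReal NNReal

namespace Summit.NavierStokesRegularity.FluidComputer.PalasekTowerClayBridge.Host.Engine

open Literature.Analysis.FluidPDE Literature.Analysis.UnboundedOperators

/-- Reflection `τ ↦ t − τ` on `(0, t)`. [folklore] -/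
theorem lintegral_Ioo_comp_sub_left (g : ℝ → ℝ≥0∞) (t : ℝ) :
    ∫⁻ τ in Ioo 0 t, g (t - τ) = ∫⁻ σ in Ioo 0 t, g σ := by
  rw [← lintegral_indicator measurableSet_Ioo, ← lintegral_indicator measurableSet_Ioo]
  have h : (fun τ => (Ioo 0 t).indicator (fun τ => g (t - τ)) τ) =
      fun τ => (Ioo 0 t).indicator g (t - τ) := by
    funext τ
    simp only [Set.indicator_apply, mem_Ioo]
    by_cases h1 : 0 < τ ∧ τ < t
    · rw [if_pos h1, if_pos ⟨by linarith [h1.2], by linarith [h1.1]⟩]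
    · rw [if_neg h1, if_neg (fun h2 => h1 ⟨by linarith [h2.2], by linarith [h2.1]⟩)]
  rw [h, lintegral_sub_left_eq_self (fun s => (Ioo 0 t).indicator g s) t]

/-- `∫_{(0,t)} σ^{-1/2} dσ = 2 t^{1/2}` in `ℝ≥0∞`. [folklore] -/
theorem lintegral_rpow_neg_half {t : ℝ} (ht : 0 < t) :
    ∫⁻ σ in Ioo 0 t, ENNReal.ofReal (σ ^ (-(1 / 2 : ℝ))) = ENNReal.ofReal (2 * t ^ (1 / 2 : ℝ)) := by
  have hr : (-1 : ℝ) < -(1 / 2 : ℝ) := by norm_num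
  have hii : IntervalIntegrable (fun σ : ℝ => σ ^ (-(1 / 2 : ℝ))) volume 0 t :=
    intervalIntegral.intervalIntegrable_rpow' hr
  have hint : IntegrableOn (fun σ : ℝ => σ ^ (-(1 / 2 : ℝ))) (Ioo 0 t) :=
    (hii.1).mono_set Ioo_subset_Ioc_self
  have hnn : 0 ≤ᵐ[volume.restrict (Ioo 0 t)] fun σ : ℝ => σ ^ (-(1 / 2 : ℝ)) :=
    (ae_restrict_mem measurableSet_Ioo).mono fun σ hσ => Real.rpow_nonneg hσ.1.le _
  rw [← ofReal_integral_eq_lintegral_ofReal hint hnn, ← integral_Ioc_eq_integral_Ioo,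
    ← intervalIntegral.integral_of_le ht.le, integral_rpow (Or.inl hr)]
  congr 1
  rw [Real.zero_rpow (by norm_num), sub_zero]
  norm_num
  ring

/-- **Sub-lemma D₁ (calculus)**: `∫_{(0,t)} (ν(t−τ))^{-1/2} dτ = 2 ν^{-1/2} t^{1/2}`. [folklore] -/
theorem lintegral_rpow_neg_half_le {ν t : ℝ} (hν : 0 < ν) (ht : 0 < t) :
    ∫⁻ τ in Ioo 0 t, ENNReal.ofReal ((ν * (t - τ)) ^ (-(1 / 2 : ℝ))) ≤
      ENNReal.ofReal (2 * ν ^ (-(1 / 2 : ℝ)) * t ^ (1 / 2 : ℝ)) := by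
  rw [lintegral_Ioo_comp_sub_left (fun σ => ENNReal.ofReal ((ν * σ) ^ (-(1 / 2 : ℝ)))) t]
  refine le_of_eq ?_
  calc ∫⁻ σ in Ioo 0 t, ENNReal.ofReal ((ν * σ) ^ (-(1 / 2 : ℝ)))
      = ∫⁻ σ in Ioo 0 t, ENNReal.ofReal (ν ^ (-(1 / 2 : ℝ))) * ENNReal.ofReal (σ ^ (-(1 / 2 : ℝ))) := by
        refine setLIntegral_congr_fun measurableSet_Ioo fun σ hσ => ?_
        rw [Real.mul_rpow hν.le hσ.1.le, ENNReal.ofReal_mul (Real.rpow_nonneg hν.le _)]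
    _ = ENNReal.ofReal (ν ^ (-(1 / 2 : ℝ))) * ENNReal.ofReal (2 * t ^ (1 / 2 : ℝ)) := by
        rw [lintegral_const_mul' _ _ ENNReal.ofReal_ne_top, lintegral_rpow_neg_half ht]
    _ = ENNReal.ofReal (2 * ν ^ (-(1 / 2 : ℝ)) * t ^ (1 / 2 : ℝ)) := by
        rw [← ENNReal.ofReal_mul (Real.rpow_nonneg hν.le _)]
        ring_nf

/-- **Sub-lemma D₂ (calculus)**: `∫_{(0,t)} (ν(t−τ))^{-3/4} g(τ) dτ ≤ 4 ν^{-3/4} t^{1/4} F` when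
`g ≤ F` on `(0, t)`. [folklore] -/
theorem lintegral_rpow_neg_three_quarters_mul_le {ν t F : ℝ} (hν : 0 < ν) (ht : 0 < t)
    {g : ℝ → ℝ≥0∞} (hg : ∀ τ ∈ Ioo 0 t, g τ ≤ ENNReal.ofReal F) :
    ∫⁻ τ in Ioo 0 t, ENNReal.ofReal ((ν * (t - τ)) ^ (-(3 / 4 : ℝ))) * g τ ≤
      ENNReal.ofReal (4 * ν ^ (-(3 / 4 : ℝ)) * t ^ (1 / 4 : ℝ) * F) := by
  calc ∫⁻ τ in Ioo 0 t, ENNReal.ofReal ((ν * (t - τ)) ^ (-(3 / 4 : ℝ))) * g τ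
      ≤ ∫⁻ τ in Ioo 0 t, ENNReal.ofReal ((ν * (t - τ)) ^ (-(3 / 4 : ℝ))) * ENNReal.ofReal F :=
        setLIntegral_mono' measurableSet_Ioo fun τ hτ => mul_le_mul' le_rfl (hg τ hτ)
    _ = (∫⁻ τ in Ioo 0 t, ENNReal.ofReal ((ν * (t - τ)) ^ (-(3 / 4 : ℝ)))) * ENNReal.ofReal F :=
        lintegral_mul_const' _ _ ENNReal.ofReal_ne_top
    _ = (∫⁻ σ in Ioo 0 t, ENNReal.ofReal ((ν * σ) ^ (-(3 / 4 : ℝ)))) * ENNReal.ofReal F := by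
        rw [lintegral_Ioo_comp_sub_left (fun σ => ENNReal.ofReal ((ν * σ) ^ (-(3 / 4 : ℝ)))) t]
    _ = (∫⁻ σ in Ioo 0 t, ENNReal.ofReal (ν ^ (-(3 / 4 : ℝ))) * ENNReal.ofReal (σ ^ (-(3 / 4 : ℝ)))) *
          ENNReal.ofReal F := by
        congr 1
        refine setLIntegral_congr_fun measurableSet_Ioo fun σ hσ => ?_
        rw [Real.mul_rpow hν.le hσ.1.le, ENNReal.ofReal_mul (Real.rpow_nonneg hν.le _)]
    _ = ENNReal.ofReal (ν ^ (-(3 / 4 : ℝ))) * ENNReal.ofReal (4 * t ^ (1 / 4 : ℝ)) * ENNReal.ofReal F := by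
        rw [lintegral_const_mul' _ _ ENNReal.ofReal_ne_top, lintegral_rpow_neg_three_quarters ht]
    _ = ENNReal.ofReal (4 * ν ^ (-(3 / 4 : ℝ)) * t ^ (1 / 4 : ℝ) * F) := by
        rw [← ENNReal.ofReal_mul (Real.rpow_nonneg hν.le _), ← ENNReal.ofReal_mul (by positivity)]
        ring_nf

/-- **The residual engine hypothesis (linear harmonic analysis only)**: the statement of sub-lemma A —
the convective pairing of a bounded continuous `L²` field against the Leray-projected heat kernel
`P(G_{ε+s}(·−x₀)e)` is `O(s^{-1/2} M² ‖e‖)`, uniformly in `ε > 0` (Oseen-tensor `L¹` bound).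
[cite: LemarieRieusset2016, Thm. 6.1 (6.11)–(6.12)] -/
@[conjecture] def OseenConvectBound : Prop :=
  ∃ C₁ : ℝ≥0, ∀ (x₀ e : (EuclideanSpace ℝ (Fin 3))) {ε s : ℝ}, 0 < ε → 0 < s →
    ∀ {a : (EuclideanSpace ℝ (Fin 3)) → (EuclideanSpace ℝ (Fin 3))}, MemLp a 2 volume → Continuous a → ∀ {M : ℝ}, (∀ x, ‖a x‖ ≤ M) →
      ‖∫ x, ⟪a x, convect a (lerayHeatTest x₀ (ε + s) e) x⟫‖ₑ ≤
        C₁ * ENNReal.ofReal (s ^ (-(1 / 2 : ℝ))) * ENNReal.ofReal (M ^ 2) * ‖e‖ₑ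

/-- `eLpNorm g 2 ≤ F` from `∫|g|² ≤ F²` (`F ≥ 0`). [folklore] -/
theorem eLpNorm_two_le_of_lintegral_sq_le {g : (EuclideanSpace ℝ (Fin 3)) → (EuclideanSpace ℝ (Fin 3))} {F : ℝ} (hF : 0 ≤ F)
    (h : ∫⁻ x, ‖g x‖ₑ ^ 2 ≤ ENNReal.ofReal (F ^ 2)) : eLpNorm g 2 volume ≤ ENNReal.ofReal F := by
  have h1 := eLpNorm_two_le_rpow_half_of_lintegral_sq_le' h
  have h2 : (ENNReal.ofReal (F ^ 2)) ^ (1 / 2 : ℝ) = ENNReal.ofReal F := by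
    rw [ENNReal.ofReal_rpow_of_nonneg (sq_nonneg F) (by norm_num), ← Real.sqrt_eq_rpow,
      Real.sqrt_sq hF]
  rw [h2] at h1
  exact h1

/-- **ASSEMBLY: the forced Leray short-time bound from the Oseen convective bound.** Time-shift the slab
to start at `0`, get Leray–Hopf-ness of the classical solution (pressure normalisation is a theorem), apply
sub-lemma C with the dispersive constant, bound the two time integrals by D₁/D₂, and choose `δ₀`.
[cite: Leray1934, §21 (3.15)] [cite: Tao2011, Prop. 9.1 (proof, (9.2))] -/
theorem forcedLerayShortTimeBound_of_oseenConvectBound (hA : OseenConvectBound) :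
    ForcedLerayShortTimeBound := by
  intro ν A M F η hν hApos hMpos hF hη
  obtain ⟨C, hC⟩ := exists_eLpNorm_top_heatExtension_le
  obtain ⟨C₁, hC₁⟩ := hA
  -- the size of the two Duhamel terms on a slab of length `δ`
  set K₁ : ℝ := (C₁ : ℝ) * M ^ 2 * (2 * ν ^ (-(1 / 2 : ℝ))) with hK₁
  set K₂ : ℝ := (C : ℝ) * (4 * ν ^ (-(3 / 4 : ℝ)) * F) with hK₂
  have hK₁0 : 0 ≤ K₁ := by positivity
  have hK₂0 : 0 ≤ K₂ := by positivity
  -- choose `δ₀ ≤ 1` with `(K₁ + K₂) δ₀^{1/4} ≤ η`; on `δ ≤ δ₀ ≤ 1`, `δ^{1/2} ≤ δ^{1/4} ≤ δ₀^{1/4}`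
  obtain ⟨δ₀, hδ₀pos, hδ₀le1, hδ₀⟩ : ∃ δ₀ : ℝ, 0 < δ₀ ∧ δ₀ ≤ 1 ∧ (K₁ + K₂) * δ₀ ^ (1 / 4 : ℝ) ≤ η := by
    by_cases hK : K₁ + K₂ = 0
    · exact ⟨1, one_pos, le_rfl, by rw [hK, zero_mul]; exact hη.le⟩
    · have hKpos : 0 < K₁ + K₂ := lt_of_le_of_ne (by positivity) (Ne.symm hK)
      set r : ℝ := min 1 (η / (K₁ + K₂)) with hr
      have hrpos : 0 < r := lt_min one_pos (div_pos hη hKpos)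
      have hrle1 : r ≤ 1 := min_le_left _ _
      refine ⟨r ^ (4 : ℝ), by positivity, ?_, ?_⟩
      · calc r ^ (4 : ℝ) ≤ 1 ^ (4 : ℝ) := Real.rpow_le_rpow hrpos.le hrle1 (by norm_num)
          _ = 1 := Real.one_rpow _
      · have hpow : (r ^ (4 : ℝ)) ^ (1 / 4 : ℝ) = r := by
          rw [← Real.rpow_mul hrpos.le]; norm_num
        rw [hpow]
        calc (K₁ + K₂) * r ≤ (K₁ + K₂) * (η / (K₁ + K₂)) :=
              mul_le_mul_of_nonneg_left (min_le_right _ _) hKpos.le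
          _ = η := mul_div_cancel₀ η hK
  refine ⟨δ₀, hδ₀pos, ?_⟩
  intro t₀ T f u p ht₀ hT hTδ hfs hfd hfF hsol hE hM hAt t ht x
  -- trivial case `t = t₀`
  rcases eq_or_lt_of_le ht.1 with heq | hlt
  · rw [← heq]
    have := hAt x
    linarith [hη.le, hApos.le]
  -- time shift to `[0, T']`, `T' = T - t₀`
  set T' : ℝ := T - t₀ with hT'
  have hT'pos : 0 < T' := by rw [hT']; linarith
  set u' : ℝ → (EuclideanSpace ℝ (Fin 3)) → (EuclideanSpace ℝ (Fin 3)) := fun s => u (s + t₀) with hu'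
  set f' : ℝ → (EuclideanSpace ℝ (Fin 3)) → (EuclideanSpace ℝ (Fin 3)) := fun s => f (s + t₀) with hf'
  set p' : ℝ → (EuclideanSpace ℝ (Fin 3)) → ℝ := fun s => p (s + t₀) with hp'
  have hpre : (fun s : ℝ => s + t₀) ⁻¹' Icc t₀ T = Icc 0 T' := by
    ext s; simp only [mem_preimage, mem_Icc, hT']; constructor <;> intro h <;> constructor <;> linarith
  have hsol' : IsClassicalNSSolutionOn (Icc 0 T') ν f' u' p' := by
    have h := hsol.comp_add_right t₀
    rw [hpre] at h
    exact h
  have hfs' : IsSmoothOnHalfSpace f' := Literature.Analysis.FluidPDE.IsSmoothOnHalfSpace.timeShift hfs ht₀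
  have hfd' : HasRapidSpaceTimeDecay f' := Literature.Analysis.FluidPDE.HasRapidSpaceTimeDecay.timeShift hfs hfd ht₀
  have hE' : ∃ Cu : ℝ≥0∞, Cu < ⊤ ∧ ∀ s ∈ Icc 0 T', ∫⁻ x, ‖u' s x‖ₑ ^ 2 ≤ Cu := by
    obtain ⟨Cu, hCu, hb⟩ := hE
    exact ⟨Cu, hCu, fun s hs => hb (s + t₀) ⟨by linarith [hs.1], by rw [hT'] at hs; linarith [hs.2]⟩⟩
  have hM' : ∀ s ∈ Icc 0 T', ∀ x, ‖u' s x‖ ≤ M := fun s hs x =>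
    hM (s + t₀) ⟨by linarith [hs.1], by rw [hT'] at hs; linarith [hs.2]⟩ x
  -- Leray–Hopf-ness of the shifted solution (pressure normalisation is a THEOREM of the tree)
  obtain ⟨Cf, Pf, hCft, hPft, hb⟩ := clayForce_slice_potential_bounds (T := T') hfs' hfd'
  have hLH : IsLerayHopfOn T' ν f' (u' 0) u' :=
    (hsol'.isLerayHopfOn_of_finiteEnergy_forced_ae tao2011_forced_pressure_normalisation_ae_holds
      hν hT'pos hCft.ne (fun s hs => (hb s hs).1) hPft.ne (fun s hs => (hb s hs).2.1)
      (fun s hs => (hb s hs).2.2) hE').1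
  -- the pointwise Duhamel bound at `s = t - t₀ ∈ (0, T']`
  set s₁ : ℝ := t - t₀ with hs₁def
  have hs₁ : s₁ ∈ Ioc 0 T' := ⟨by rw [hs₁def]; linarith, by rw [hs₁def, hT']; linarith [ht.2]⟩
  have hs₁δ : s₁ ≤ δ₀ := by rw [hs₁def]; linarith [ht.2]
  have hDuh := enorm_sub_heatExtension_le_of_bounded hν hT'pos hsol' hLH
    (clayForce_prod_aestronglyMeasurable (T := T') hfs') (clayForce_prod_eLpNorm_lt_top (T := T') hfs' hfd')
    hE' hM' hC hC₁ hs₁ x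
  -- the two time integrals
  have hI₁ : (C₁ : ℝ≥0∞) * ENNReal.ofReal (M ^ 2) *
      (∫⁻ τ in Ioo 0 s₁, ENNReal.ofReal ((ν * (s₁ - τ)) ^ (-(1 / 2 : ℝ)))) ≤
      ENNReal.ofReal (K₁ * δ₀ ^ (1 / 4 : ℝ)) := by
    calc (C₁ : ℝ≥0∞) * ENNReal.ofReal (M ^ 2) *
          (∫⁻ τ in Ioo 0 s₁, ENNReal.ofReal ((ν * (s₁ - τ)) ^ (-(1 / 2 : ℝ))))
        ≤ (C₁ : ℝ≥0∞) * ENNReal.ofReal (M ^ 2) * ENNReal.ofReal (2 * ν ^ (-(1 / 2 : ℝ)) * s₁ ^ (1 / 2 : ℝ)) :=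
          mul_le_mul' le_rfl (lintegral_rpow_neg_half_le hν hs₁.1)
      _ = ENNReal.ofReal (K₁ * s₁ ^ (1 / 2 : ℝ)) := by
          rw [← ENNReal.ofReal_coe_nnreal, ← ENNReal.ofReal_mul (NNReal.coe_nonneg _),
            ← ENNReal.ofReal_mul (by positivity)]
          congr 1
          rw [hK₁]; ring
      _ ≤ ENNReal.ofReal (K₁ * δ₀ ^ (1 / 4 : ℝ)) := by
          refine ENNReal.ofReal_le_ofReal (mul_le_mul_of_nonneg_left ?_ hK₁0)
          calc s₁ ^ (1 / 2 : ℝ) ≤ s₁ ^ (1 / 4 : ℝ) :=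
                Real.rpow_le_rpow_of_exponent_ge hs₁.1 (hs₁δ.trans hδ₀le1) (by norm_num)
            _ ≤ δ₀ ^ (1 / 4 : ℝ) := Real.rpow_le_rpow hs₁.1.le hs₁δ (by norm_num)
  have hI₂ : (C : ℝ≥0∞) * (∫⁻ τ in Ioo 0 s₁, ENNReal.ofReal ((ν * (s₁ - τ)) ^ (-(3 / 4 : ℝ))) *
      eLpNorm (f' τ) 2 volume) ≤ ENNReal.ofReal (K₂ * δ₀ ^ (1 / 4 : ℝ)) := by
    have hg : ∀ τ ∈ Ioo 0 s₁, eLpNorm (f' τ) 2 volume ≤ ENNReal.ofReal F := fun τ hτ =>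
      eLpNorm_two_le_of_lintegral_sq_le hF
        (hfF (τ + t₀) ⟨by linarith [hτ.1], by rw [hs₁def] at hτ; linarith [hτ.2, ht.2]⟩)
    calc (C : ℝ≥0∞) * (∫⁻ τ in Ioo 0 s₁, ENNReal.ofReal ((ν * (s₁ - τ)) ^ (-(3 / 4 : ℝ))) *
          eLpNorm (f' τ) 2 volume)
        ≤ (C : ℝ≥0∞) * ENNReal.ofReal (4 * ν ^ (-(3 / 4 : ℝ)) * s₁ ^ (1 / 4 : ℝ) * F) :=
          mul_le_mul' le_rfl (lintegral_rpow_neg_three_quarters_mul_le hν hs₁.1 hg)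
      _ = ENNReal.ofReal (K₂ * s₁ ^ (1 / 4 : ℝ)) := by
          rw [← ENNReal.ofReal_coe_nnreal, ← ENNReal.ofReal_mul (NNReal.coe_nonneg _)]
          congr 1
          rw [hK₂]; ring
      _ ≤ ENNReal.ofReal (K₂ * δ₀ ^ (1 / 4 : ℝ)) :=
          ENNReal.ofReal_le_ofReal (mul_le_mul_of_nonneg_left
            (Real.rpow_le_rpow hs₁.1.le hs₁δ (by norm_num)) hK₂0)
  have hsum : ‖u' s₁ x - heatExtension (u' 0) (ν * s₁) x‖ₑ ≤ ENNReal.ofReal η := by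
    refine hDuh.trans ((add_le_add hI₁ hI₂).trans ?_)
    rw [← ENNReal.ofReal_add (by positivity) (by positivity)]
    refine ENNReal.ofReal_le_ofReal ?_
    calc K₁ * δ₀ ^ (1 / 4 : ℝ) + K₂ * δ₀ ^ (1 / 4 : ℝ) = (K₁ + K₂) * δ₀ ^ (1 / 4 : ℝ) := by ring
      _ ≤ η := hδ₀
  have hsum' : ‖u' s₁ x - heatExtension (u' 0) (ν * s₁) x‖ ≤ η := by
    rw [← ofReal_norm, ENNReal.ofReal_le_ofReal_iff hη.le] at hsum
    exact hsum
  -- the free term: heat extension of a field bounded by `A`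
  have hfree : ‖heatExtension (u' 0) (ν * s₁) x‖ ≤ A := by
    refine norm_heatExtension_le (fun z => ?_) (mul_pos hν hs₁.1) x
    show ‖u (0 + t₀) z‖ ≤ A
    rw [zero_add]; exact hAt z
  -- conclude
  have hut : u t x = u' s₁ x := by
    show u t x = u (s₁ + t₀) x
    rw [hs₁def, sub_add_cancel]
  rw [hut]
  calc ‖u' s₁ x‖ = ‖heatExtension (u' 0) (ν * s₁) x + (u' s₁ x - heatExtension (u' 0) (ν * s₁) x)‖ := by
        rw [add_sub_cancel]
    _ ≤ ‖heatExtension (u' 0) (ν * s₁) x‖ + ‖u' s₁ x - heatExtension (u' 0) (ν * s₁) x‖ :=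
        norm_add_le _ _
    _ ≤ A + η := add_le_add hfree hsum'
    _ ≤ 2 * A + η := by linarith

end Summit.NavierStokesRegularity.FluidComputer.PalasekTowerClayBridge.Host.Engine

end
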